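import Summits.ABC.ABC.Theorems.DefiniteXiFreyModularityStubFreyCaseBThreeReducible
import Literature.NumberTheory.EllipticCurves.ThreeDivisionFieldSwanProofs
import Literature.NumberTheory.EllipticCurves.OpenImageMazurProofs
import Mathlib.RingTheory.Polynomial.RationalRoot
import Mathlib.Tactic.ComputeDegree
import HarnessLib

/-!
# Crux `EisensteinQuarantine` (stmt-ABC-15023), line `forced-pair-dlog`: the registered stub
# `stub_forcedCaseA` — the forced Legendre–Frey family is in case A at `3`

Support file for the crux `Summit.ABC.ABC.Theses.DefiniteXi.EisensteinQuarantine`, line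
`forced-pair-dlog` (skeleton `Cruxes/EisensteinQuarantine/Lines/forced_pair_dlog.lean`), registered
stub `stub_forcedCaseA` (STUB-PLAN `stub_freyModularity`, plan P1, stub 2c).  The line consumes the
modularity of the Frey curve only on the FORCED family `E_ℓ := E_(−ℓ, ℓ−1)` (`ℓ` prime, `32 ∣ ℓ − 1`),
which in the coordinate `X = x + ℓ` is the integer-`λ` Legendre curve `Y² = X(X−1)(X−λ)`, `λ = ℓ`.
This file proves, unconditionally, that every such curve is in **case A** of Conrad–Diamond–Taylor
1999 (proof of Thm. 7.1.2): some framed model of `E_ℓ[3]` is absolutely irreducible over `ℚ(√−3)`,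
so that on this family modularity is Wiles 1995 Thm 0.3 / CDT 1999 Thm 7.2.1 alone (Langlands–Tunnell
and lifting at `3`; no `3–5` switch, no lifting at `5`).

The mechanism is elementary:
* `four_mul_cube_eq_sq` — the Diophantine core: `4 m³ (m − 3)³ = R²` in integers forces
  `m ∈ {−1, 0, 3, 4}`;
* `legendrePsi3_ne_zero` — for an INTEGER `λ ∉ {0, 1}` the Legendre `3`-division polynomial
  `Ψ₃^{Leg}_λ(X) = 3X⁴ − 4(1+λ)X³ + 6λX² − λ²` has no rational root: `3X` is a root of a monic integer
  quartic, hence an integer `m` (integral root theorem), and `729 · Ψ₃(m/3) = 4m³(m−3)³ − (27λ − 9m² + 2m³)²`;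
  the four exceptional `m` give `27λ ∈ {−5, 0, 27, 32}`.  (Sharp: `λ = 32/27`, the case-B witness
  `5 + 27 = 32`, has the root `4/3`.)
* `eval_psi3_forcedFrey_eq` — `Ψ₃(E_ℓ)(x) = Ψ₃^{Leg}_ℓ(x + ℓ)`, so `Ψ₃(E_ℓ)` has no rational root;
* `hasIrreducibleModPGaloisRep_three_of_forall_eval_psi3_ne_zero` — for any elliptic `W/ℚ`, if `Ψ₃`
  has no rational root then `E[3]` has no `Γ_ℚ`-stable line (the `x`-coordinate of a generator of a
  stable line `{O, ±P}` is `Γ_ℚ`-fixed, hence rational, hence a root of `Ψ₃`);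
* the landed case-B theorem `exists_stableLine_three_freyCurve_of_caseB` (Diamond–Kramer + Serre's
  Prop. 21: on the normalised Frey family, case B produces a stable line) then gives case A by
  contraposition (`caseA_freyCurve_of_forall_eval_psi3_ne_zero`), and the normalisation
  `−ℓ ≡ −1 (mod 4)`, `2 ∣ ℓ − 1` holds on the forced family.

Nothing is defined; no named fact is used.

## References

* [ConradDiamondTaylor1999] B. Conrad, F. Diamond, R. Taylor, J. Amer. Math. Soc. 12 (1999), proof of
  Thm. 7.1.2 (p. 556) and Thm. 7.2.1.
* [Serre1972] J.-P. Serre, Invent. Math. 15 (1972), §5.4 Prop. 21.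
* [DiamondKramer1995] F. Diamond, K. Kramer, Math. Res. Lett. 2 (1995), Lemmas 1–3.
* [SilvermanAEC2009] J. Silverman, *The Arithmetic of Elliptic Curves*, 2nd ed., Exercise 3.7, III.§7.
-/

noncomputable section

open Field
open Literature.NumberTheory.EllipticCurves
open Literature.NumberTheory.Automorphic
open Literature.NumberTheory.GaloisRepresentations
open WeierstrassCurve Polynomial

namespace Summit.ABC.ABC.Theorems

/-! ## The Diophantine core and the Legendre `Ψ₃` rigidity -/

/-- **Diophantine core.**  `4 m³ (m − 3)³ = R²` in integers forces `m ∈ {−1, 0, 3, 4}`: with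
`t := m(m − 3)`, `4t³ = R²` gives `t ≥ 0`, `R = 2s`, `t³ = s²`, so `t ∣ s` and `t = k²`; then
`(2m − 3)² = 4k² + 9` lies strictly between `(2|k|)²` and `(2|k| + 1)²` unless `|k| ≤ 2`. [folklore] -/
theorem four_mul_cube_eq_sq (m R : ℤ) (h : 4 * m ^ 3 * (m - 3) ^ 3 = R ^ 2) :
    m = -1 ∨ m = 0 ∨ m = 3 ∨ m = 4 := by
  set t : ℤ := m * (m - 3) with ht
  have h4 : 4 * t ^ 3 = R ^ 2 := by rw [← h, ht]; ring
  -- `t ≥ 0`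
  have ht0 : 0 ≤ t := by
    have : 0 ≤ t ^ 3 := by nlinarith [sq_nonneg R]
    exact (Odd.pow_nonneg_iff (by decide : Odd 3)).mp this
  -- `R = 2 s`, `t³ = s²`
  have hReven : Even R := by
    have : Even (R ^ 2) := ⟨2 * t ^ 3, by rw [← h4]; ring⟩
    exact (Int.even_pow.mp this).1
  obtain ⟨s, hs⟩ := hReven
  have hts : t ^ 3 = s ^ 2 := by
    have h' : 4 * t ^ 3 = 4 * s ^ 2 := by rw [h4, hs]; ring
    linarith
  -- `t = k²`
  obtain ⟨k, hk⟩ : ∃ k : ℤ, t = k ^ 2 := by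
    rcases ht0.eq_or_lt with h0 | hpos
    · exact ⟨0, by rw [← h0]; ring⟩
    · have hdvd : t ∣ s := by
        have h2 : t ^ 2 ∣ s ^ 2 := ⟨t, by rw [← hts]; ring⟩
        rw [← Int.natAbs_dvd_natAbs, Int.natAbs_pow, Int.natAbs_pow] at h2
        exact Int.natAbs_dvd_natAbs.mp ((Nat.pow_dvd_pow_iff two_ne_zero).mp h2)
      obtain ⟨k, rfl⟩ := hdvd
      refine ⟨k, ?_⟩
      have ht2 : t ^ 2 ≠ 0 := pow_ne_zero _ hpos.ne'
      have : t ^ 2 * t = t ^ 2 * k ^ 2 := by rw [← pow_succ, hts]; ring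
      exact mul_left_cancel₀ ht2 this
  -- `(2m − 3)² = 4 K² + 9` with `K = |k| ≤ 2`
  obtain ⟨K, hK0, hKk⟩ : ∃ K : ℤ, 0 ≤ K ∧ K ^ 2 = k ^ 2 := ⟨|k|, abs_nonneg k, sq_abs k⟩
  have hsq : (2 * m - 3) ^ 2 = 4 * K ^ 2 + 9 := by rw [hKk, ← hk, ht]; ring
  have hK2 : K ≤ 2 := by
    by_contra hK3
    push Not at hK3
    obtain ⟨A, hA0, hAm⟩ : ∃ A : ℤ, 0 ≤ A ∧ A ^ 2 = (2 * m - 3) ^ 2 :=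
      ⟨|2 * m - 3|, abs_nonneg _, sq_abs _⟩
    rw [hsq] at hAm
    rcases le_or_gt A (2 * K) with hle | hlt
    · nlinarith [mul_le_mul hle hle hA0 (by linarith : (0 : ℤ) ≤ 2 * K)]
    · have hge : 2 * K + 1 ≤ A := hlt
      nlinarith [mul_le_mul hge hge (by linarith : (0 : ℤ) ≤ 2 * K + 1) hA0]
  -- bound `m` and finish by cases
  have hm4 : m ≤ 4 := by nlinarith [hsq, sq_nonneg K]
  have hm1 : -1 ≤ m := by nlinarith [hsq, sq_nonneg K]
  interval_cases K <;> interval_cases m <;> omega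

/-- **The Legendre `Ψ₃` rigidity.**  For an INTEGER `λ ∉ {0, 1}` the `3`-division polynomial of the
Legendre curve `Y² = X(X−1)(X−λ)`, namely `3X⁴ − 4(1+λ)X³ + 6λX² − λ²`, has no rational root:
`3X` is a root of the monic integer quartic `T⁴ − 4(1+λ)T³ + 18λT² − 27λ²`, hence an integer `m`
(integral root theorem), and `729 · Ψ₃(m/3) = 4m³(m−3)³ − (27λ − 9m² + 2m³)²`, so
`four_mul_cube_eq_sq` leaves `27λ ∈ {−5, 0, 27, 32}`.  Equivalently: an integer-`λ` Legendre curve,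
`λ ≠ 0, 1`, admits no rational `3`-isogeny. [folklore] -/
theorem legendrePsi3_ne_zero (la : ℤ) (h0 : la ≠ 0) (h1 : la ≠ 1) (X : ℚ) :
    3 * X ^ 4 - 4 * (1 + (la : ℚ)) * X ^ 3 + 6 * (la : ℚ) * X ^ 2 - (la : ℚ) ^ 2 ≠ 0 := by
  intro hX
  -- `3 X` is a root of a monic integer quartic, hence an integer
  set a : ℤ := -(4 * (1 + la)) with ha
  set b : ℤ := 18 * la with hb
  set c : ℤ := -(27 * la ^ 2) with hc
  set Q : ℤ[X] := Polynomial.X ^ 4 + C a * Polynomial.X ^ 3 + C b * Polynomial.X ^ 2 + C c with hQ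
  have hQm : Q.Monic := by
    rw [hQ]
    monicity!
  have hroot : aeval (3 * X) Q = 0 := by
    rw [hQ]
    simp only [map_add, map_mul, map_pow, aeval_X, aeval_C]
    simp only [algebraMap_int_eq, eq_intCast, ha, hb, hc]
    push_cast
    linear_combination 27 * hX
  obtain ⟨m, hm, -⟩ := exists_integer_of_is_root_of_monic hQm hroot
  rw [algebraMap_int_eq, eq_intCast] at hm
  -- substitute `X = m / 3` and clear denominators
  have hXm : X = (m : ℚ) / 3 := by rw [← hm]; ring
  have key : (4 * m ^ 3 * (m - 3) ^ 3 : ℤ) = (27 * la - 9 * m ^ 2 + 2 * m ^ 3) ^ 2 := by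
    have : (4 * (m : ℚ) ^ 3 * (m - 3) ^ 3) = (27 * la - 9 * (m : ℚ) ^ 2 + 2 * m ^ 3) ^ 2 := by
      rw [hXm] at hX
      linear_combination 729 * hX
    exact_mod_cast this
  rcases four_mul_cube_eq_sq m _ key with rfl | rfl | rfl | rfl
  · have e : (la - 1) * (27 * la + 5) = 0 := by nlinarith [key]
    rcases mul_eq_zero.mp e with e | e <;> omega
  · have e : la ^ 2 = 0 := by nlinarith [key]
    exact h0 (sq_eq_zero_iff.mp e)
  · have e : (la - 1) ^ 2 = 0 := by nlinarith [key]
    have e' : la - 1 = 0 := sq_eq_zero_iff.mp e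
    exact h1 (by omega)
  · have e : la * (27 * la - 32) = 0 := by nlinarith [key]
    rcases mul_eq_zero.mp e with e | e <;> omega

/-! ## `Ψ₃` of the forced Legendre–Frey curve `E_(−ℓ, ℓ−1)` -/

/-- **`Ψ₃(E_ℓ)(x) = Ψ₃^{Leg}_ℓ(x + ℓ)`**: the `3`-division polynomial of the forced Frey curve
`E_(−ℓ, ℓ−1) : y² = x(x+ℓ)(x+ℓ−1)` is the Legendre one with `λ = ℓ` in the coordinate `X = x + ℓ`.
[folklore] -/
theorem eval_psi3_forcedFrey_eq (ℓ : ℕ) (hℓ : 1 ≤ ℓ) (x : ℚ) :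
    (freyCurve (-(ℓ : ℤ)) ((ℓ - 1 : ℕ) : ℤ)).Ψ₃.eval x =
      3 * (x + ℓ) ^ 4 - 4 * (1 + (ℓ : ℚ)) * (x + ℓ) ^ 3 + 6 * (ℓ : ℚ) * (x + ℓ) ^ 2 - (ℓ : ℚ) ^ 2 := by
  simp only [freyCurve, Ψ₃, b₂, b₄, b₆, b₈, eval_add, eval_mul, eval_pow, eval_C, eval_X,
    eval_ofNat, Int.cast_neg, Int.cast_natCast, Nat.cast_sub hℓ, Nat.cast_one, Int.cast_sub,
    Int.cast_one]
  ring

/-- **`Ψ₃(E_ℓ)` has no rational root for `ℓ ≥ 2`** (`eval_psi3_forcedFrey_eq` and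
`legendrePsi3_ne_zero` at the integer `λ = ℓ ∉ {0, 1}`). [folklore] -/
theorem eval_psi3_forcedFrey_ne_zero (ℓ : ℕ) (hℓ : 2 ≤ ℓ) (x : ℚ) :
    (freyCurve (-(ℓ : ℤ)) ((ℓ - 1 : ℕ) : ℤ)).Ψ₃.eval x ≠ 0 := by
  rw [eval_psi3_forcedFrey_eq ℓ (by omega) x]
  have h := legendrePsi3_ne_zero (ℓ : ℤ) (by exact_mod_cast (show ℓ ≠ 0 by omega))
    (by exact_mod_cast (show ℓ ≠ 1 by omega)) (x + ℓ)
  simpa using h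

/-! ## No rational root of `Ψ₃` ⟹ no `Γ_ℚ`-stable line in `E[3]` -/

/-- **Galois descent for elements**: an element of `F̄` fixed by every `σ ∈ Gal(F̄/F)` lies in `F`
(`F` of characteristic `0`, hence perfect, so `F̄/F` is Galois; Mathlib
`InfiniteGalois.mem_range_algebraMap_iff_fixed`).  Stated for a general field so that the
`F`-algebra structure of `F̄` is the canonical one. [folklore] -/
theorem exists_algebraMap_eq_of_forall_algEquiv_apply_eq {F : Type*} [Field F] [CharZero F]
    {x : AlgebraicClosure F} (hx : ∀ σ : AlgebraicClosure F ≃ₐ[F] AlgebraicClosure F, σ x = x) :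
    ∃ c : F, algebraMap F (AlgebraicClosure F) c = x := by
  haveI : Algebra.IsAlgebraic F (AlgebraicClosure F) :=
    @IsAlgClosure.isAlgebraic F (AlgebraicClosure F) _ _ (AlgebraicClosure.instAlgebra F) _
      inferInstance
  haveI : Algebra.IsSeparable F (AlgebraicClosure F) :=
    Algebra.IsAlgebraic.isSeparable_of_perfectField
  haveI : Normal F (AlgebraicClosure F) :=
    @IsAlgClosure.normal F (AlgebraicClosure F) _ _ (AlgebraicClosure.instAlgebra F) inferInstance
  haveI : IsGalois F (AlgebraicClosure F) := {}
  exact (InfiniteGalois.mem_range_algebraMap_iff_fixed x).mpr fun σ => hx σ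

/-- **If `Ψ₃` has no rational root, the mod-`3` representation is irreducible.**  For an elliptic
curve `W/ℚ`: a `Γ_ℚ`-stable subgroup `H ∉ {⊥, ⊤}` of `E[3]` has order `3`, `H = {O, ±P}`
(`exists_eq_zmultiples_of_natCard_eq`), and `Γ_ℚ` acts on `P` through the isogeny character,
`σ P = ±P` (`exists_isogenyCharacter`); since `P = (x, y)` and `−P = (x, −y − a₁x − a₃)` have the same
`x`-coordinate, `σ x = x` for all `σ ∈ Γ_ℚ`, so `x ∈ ℚ` (Galois descent,
`InfiniteGalois.mem_range_algebraMap_iff_fixed`) and `Ψ₃(x) = 0`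
(`eval_divisionPolynomial_three_eq_zero_of_eq_some`) — a rational root of `Ψ₃`.  This is the
dictionary "rational `3`-isogeny ⟺ rational root of `Ψ₃`" (Silverman, *AEC* III.4.12–13, Ex. 3.7).
[cite: SilvermanAEC2009, Exercise 3.7 and Remark III.4.13.2] -/
theorem hasIrreducibleModPGaloisRep_three_of_forall_eval_psi3_ne_zero (W : WeierstrassCurve ℚ)
    [W.IsElliptic] (h : ∀ x : ℚ, W.Ψ₃.eval x ≠ 0) : W.HasIrreducibleModPGaloisRep 3 := by
  classical
  haveI : Fact (Nat.Prime 3) := ⟨Nat.prime_three⟩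
  haveI : NeZero ((3 : ℕ) : ℚ) := ⟨by norm_num⟩
  by_contra hred
  obtain ⟨H, hH, hcard⟩ :=
    (Mazur1978.not_hasIrreducibleModPGaloisRep_iff_exists_natCard_eq W 3).mp hred
  obtain ⟨P, hP0, rfl⟩ := Mazur1978.exists_eq_zmultiples_of_natCard_eq W 3 hcard
  have hst : ∀ σ : absoluteGaloisGroup ℚ, σ • P ∈ AddSubgroup.zmultiples P :=
    fun σ ↦ hH σ P (AddSubgroup.mem_zmultiples P)
  obtain ⟨r, hr⟩ := Mazur1978.exists_isogenyCharacter W 3 hP0 hst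
  -- `σ • P = P` or `σ • P = -P`
  have h2P : (2 : ℕ) • P = -P := by
    have h3 : (2 : ℕ) • P + P = 0 := by
      rw [← succ_nsmul]
      exact AddSubgroup.torsionBy.nsmul P
    exact eq_neg_of_add_eq_zero_left h3
  have hpm : ∀ σ : absoluteGaloisGroup ℚ, σ • P = P ∨ σ • P = -P := by
    intro σ
    have hv := hr σ
    have hlt : ((r σ : (ZMod 3)ˣ) : ZMod 3).val < 3 := ZMod.val_lt _
    have hne : ((r σ : (ZMod 3)ˣ) : ZMod 3).val ≠ 0 := by
      rw [Ne, ZMod.val_eq_zero]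
      exact (r σ).ne_zero
    generalize ((r σ : (ZMod 3)ˣ) : ZMod 3).val = v at hv hlt hne
    obtain rfl | rfl : v = 1 ∨ v = 2 := by omega
    · left; simpa using hv
    · right; rw [hv, h2P]
  -- the point `P = (x, y)` and its `x`-coordinate
  obtain ⟨Q, hQmem⟩ := P
  have hQ0 : Q ≠ 0 := fun hQ ↦ hP0 (Subtype.ext hQ)
  change (W.baseChange (AlgebraicClosure ℚ)).toAffine.Point at Q
  rcases Q with _ | ⟨x, y, hxy⟩
  · exact hQ0 rfl
  -- `σ x = x` for every `σ`
  have hx : ∀ σ : AlgebraicClosure ℚ ≃ₐ[ℚ] AlgebraicClosure ℚ, σ x = x := by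
    intro σ
    rcases hpm σ with hσ | hσ
    · have hσ' := congrArg Subtype.val hσ
      change Affine.Point.map (σ : AlgebraicClosure ℚ →ₐ[ℚ] AlgebraicClosure ℚ)
        (Affine.Point.some x y hxy) = Affine.Point.some x y hxy at hσ'
      rw [Affine.Point.map_some] at hσ'
      simpa only [Affine.Point.some.injEq, AlgEquiv.coe_toAlgHom] using (Affine.Point.some.inj hσ').1
    · have hσ' := congrArg Subtype.val hσ
      change Affine.Point.map (σ : AlgebraicClosure ℚ →ₐ[ℚ] AlgebraicClosure ℚ)
        (Affine.Point.some x y hxy) = -Affine.Point.some x y hxy at hσ'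
      rw [Affine.Point.map_some, Affine.Point.neg_some] at hσ'
      simpa only [Affine.Point.some.injEq, AlgEquiv.coe_toAlgHom] using (Affine.Point.some.inj hσ').1
  obtain ⟨x₀, hx₀⟩ := exists_algebraMap_eq_of_forall_algEquiv_apply_eq hx
  -- `Ψ₃(x) = 0` over `ℚ̄` descends to `Ψ₃(x₀) = 0` over `ℚ`
  have hΨ : (W.baseChange (AlgebraicClosure ℚ)).Ψ₃.eval x = 0 :=
    W.eval_divisionPolynomial_three_eq_zero_of_eq_some (T := ⟨Affine.Point.some x y hxy, hQmem⟩) rfl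
  rw [← hx₀, WeierstrassCurve.baseChange, map_Ψ₃, eval_map] at hΨ
  have hΨ' : algebraMap ℚ (AlgebraicClosure ℚ) (W.Ψ₃.eval x₀) = 0 := by
    rwa [← eval₂_at_apply]
  exact h x₀ ((map_eq_zero_iff _ (algebraMap ℚ (AlgebraicClosure ℚ)).injective).mp hΨ')

/-! ## Case A on the normalised Frey family with root-free `Ψ₃`, and on the forced family -/

/-- **Root-free `Ψ₃` ⟹ case A, on the normalised Frey family.**  For coprime `A, B` with
`AB(A+B) ≠ 0`, `A ≡ −1 (mod 4)`, `2 ∣ B`: if `Ψ₃(E_(A,B))` has no rational root then some framed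
model of `E_(A,B)[3]` is absolutely irreducible over `ℚ(√−3)` — otherwise (case B) the landed
`exists_stableLine_three_freyCurve_of_caseB` (Diamond–Kramer: `16 ∣ B`, semistable; Serre's Prop. 21)
produces a `Γ_ℚ`-stable line in `E[3]`, against
`hasIrreducibleModPGaloisRep_three_of_forall_eval_psi3_ne_zero`.
[cite: Serre1972, §5.4 Prop. 21] [cite: DiamondKramer1995, Lemmas 1–3] -/
theorem caseA_freyCurve_of_forall_eval_psi3_ne_zero {A B : ℤ} (hAB : IsCoprime A B)
    (h0 : A * B * (A + B) ≠ 0) (hA : A ≡ -1 [ZMOD 4]) (h2 : (2 : ℤ) ∣ B)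
    (hΨ : ∀ x : ℚ, (freyCurve A B).Ψ₃.eval x ≠ 0) :
    ∃ ρ : ModPGaloisRep ℚ (ZMod 3) 2,
      (freyCurve A B).IsTorsionGaloisRep 3 ρ ∧ ρ.IsAbsIrreducibleOverSqrt (-3) := by
  haveI := isElliptic_freyCurve h0
  by_contra hcon
  push Not at hcon
  obtain ⟨H, hstab, hbot, htop, -⟩ := exists_stableLine_three_freyCurve_of_caseB hAB h0 hA h2 hcon
  rcases hasIrreducibleModPGaloisRep_three_of_forall_eval_psi3_ne_zero _ hΨ H hstab with h | h
  · exact hbot h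
  · exact htop h

/-- Domain facts of the forced family: `(−ℓ) ⊥ (ℓ−1)` and `(−ℓ)(ℓ−1)(−1) = ℓ(ℓ−1) ≠ 0` for `ℓ`
prime. [folklore] -/
theorem forcedFrey_domain {ℓ : ℕ} (hℓ : ℓ.Prime) :
    IsCoprime (-(ℓ : ℤ)) ((ℓ - 1 : ℕ) : ℤ) ∧
      (-(ℓ : ℤ)) * ((ℓ - 1 : ℕ) : ℤ) * (-(ℓ : ℤ) + ((ℓ - 1 : ℕ) : ℤ)) ≠ 0 := by
  have hℓ1 : 1 ≤ ℓ := hℓ.one_lt.le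
  have hM0 : ℓ - 1 ≠ 0 := by have := hℓ.two_le; omega
  have hℓcast : (ℓ : ℤ) = ((ℓ - 1 : ℕ) : ℤ) + 1 := by
    rw [Nat.cast_sub hℓ1]; push_cast; ring
  have habc : (-(ℓ : ℤ)) * ((ℓ - 1 : ℕ) : ℤ) * (-(ℓ : ℤ) + ((ℓ - 1 : ℕ) : ℤ)) =
      ((ℓ * (ℓ - 1) : ℕ) : ℤ) := by
    push_cast; rw [hℓcast]; ring
  have hPM0 : ℓ * (ℓ - 1) ≠ 0 := Nat.mul_ne_zero hℓ.ne_zero hM0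
  refine ⟨?_, ?_⟩
  · rw [IsCoprime.neg_left_iff, Int.isCoprime_iff_gcd_eq_one, Int.gcd_natCast_natCast]
    exact (Nat.coprime_self_sub_right hℓ1).mpr (Nat.coprime_one_right ℓ)
  · rw [habc]; exact_mod_cast hPM0

/-- Serre normalisation of the forced family: `−ℓ ≡ −1 (mod 4)` and `2 ∣ ℓ − 1` when `32 ∣ ℓ − 1`.
[folklore] -/
theorem forcedFrey_serre {ℓ : ℕ} (hℓ : ℓ.Prime) (h32 : 32 ∣ ℓ - 1) :
    (-(ℓ : ℤ)) ≡ -1 [ZMOD 4] ∧ (2 : ℤ) ∣ ((ℓ - 1 : ℕ) : ℤ) := by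
  have hℓ1 : 1 ≤ ℓ := hℓ.one_lt.le
  have hℓcast : (ℓ : ℤ) = ((ℓ - 1 : ℕ) : ℤ) + 1 := by
    rw [Nat.cast_sub hℓ1]; push_cast; ring
  have hb32 : (32 : ℤ) ∣ ((ℓ - 1 : ℕ) : ℤ) := by exact_mod_cast h32
  refine ⟨?_, (show (2 : ℤ) ∣ 32 by norm_num).trans hb32⟩
  have h4 : (4 : ℤ) ∣ ((ℓ - 1 : ℕ) : ℤ) := (show (4 : ℤ) ∣ 32 by norm_num).trans hb32
  have : (-(ℓ : ℤ)) = -1 - ((ℓ - 1 : ℕ) : ℤ) := by rw [hℓcast]; ring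
  rw [this]
  calc -1 - ((ℓ - 1 : ℕ) : ℤ) ≡ -1 - 0 [ZMOD 4] :=
      Int.ModEq.sub_left _ ((Int.modEq_zero_iff_dvd).mpr h4)
    _ = -1 := by ring

/-- **Registered stub `stub_forcedCaseA`** (crux `EisensteinQuarantine`, stmt-ABC-15023, line
`forced-pair-dlog`; STUB-PLAN `stub_freyModularity`, plan P1, stub 2c), verbatim name and signature:
every forced Legendre–Frey curve `E_(−ℓ, ℓ−1)` (`ℓ` prime, `32 ∣ ℓ − 1`) is in **case A** at `3` —
some framed model of `E[3]` is absolutely irreducible over `ℚ(√−3)`.  So on this family the modularity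
the line consumes is Conrad–Diamond–Taylor 1999 Thm. 7.2.1 (Wiles 1995 Thm. 0.3) alone: the `3–5`
switch and lifting at `5` are never taken.
[cite: ConradDiamondTaylor1999, proof of Thm. 7.1.2 (p. 556)] [cite: Serre1972, §5.4 Prop. 21] -/
theorem stub_forcedCaseA :
    ∀ ℓ : ℕ, ℓ.Prime → 32 ∣ ℓ - 1 →
      ∃ ρ : ModPGaloisRep ℚ (ZMod 3) 2,
        (freyCurve (-(ℓ : ℤ)) ((ℓ - 1 : ℕ) : ℤ)).IsTorsionGaloisRep 3 ρ ∧
          ρ.IsAbsIrreducibleOverSqrt (-3) := by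
  intro ℓ hℓ h32
  obtain ⟨hab, h0⟩ := forcedFrey_domain hℓ
  obtain ⟨ha4, hb2⟩ := forcedFrey_serre hℓ h32
  exact caseA_freyCurve_of_forall_eval_psi3_ne_zero hab h0 ha4 hb2
    (eval_psi3_forcedFrey_ne_zero ℓ hℓ.two_le)

end Summit.ABC.ABC.Theorems

end
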